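/-
Copyright (c) 2026 the pub-hodgecm-mathlib formalisation cell (harness21).  Prover seat hodgecm-mathlib-LH4-p01 (g6): LH4-plan (g6) WORD #125 «CENSUS-M1 row #7» — the ½-free
twin of ★ F0P3a-p04 (g12)'s (F12) HEAD 3 «STUB-FRAME ADAPTER, TYPE (1)» over the TRACE FRAME (FINDING OF RECORD #4); 2026-09-02.
-/
import Literature.NumberTheory.Rogawski1990.UnitFundamentalLemmaInertSplitClauseOfValues        -- ★ p841086 (F0P3a-p04): HEAD 1, values-abstract assembly (2-free)
import Literature.NumberTheory.Rogawski1990.FlickerRepresentativesTraceFrame                    -- ★ p851833 (this seat): the four matched TRACE representatives (brings ★ p851771 signs, ★ `FlickerTraceFramePermutation`, ★ p851724)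
import Literature.NumberTheory.Rogawski1990.FinExplicitTransferFactorInertExponent               -- ★ p840918 (A-p13): `log |χ_g(u)|_w = −(N₁+N₂)`, `χ_g(u)` a unit (2-free)
import Literature.NumberTheory.Automorphic.LocalRegularOrbitClosed                               -- ★ `map_conjLocal_transpose_localForm`, `isUnit_det_localForm`
import HarnessLib

/-!
# The type-(1) `G′`-side sum FROM THE FOUR VALUES in the stub frame — TRACE-FRAME twin (no `½`, no `x x̄ = 2`, no `y ȳ = −2`, no `|2| = 1`)
# (Flicker 1998 Prop. 3 p. 78, §6 p. 95; Rogawski 1990 Prop. 4.9.1 (b), (4.3.1)–(4.3.2); Jacobowitz 1962 §7)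

Topic `NumberTheory/Rogawski1990`; namespace `Literature.NumberTheory.Rogawski1990`.  THEOREMS ONLY (no definition, no instance, no notation, no named fact, no `sorry`);
count-neutral; kernel lane `--supports stmt-HodgeConjecture-24833`.  Cell `pub/hodgecm-mathlib` (D-0151), crux H413 = `stmt-HodgeConjecture-24833`, half A line LH4 (dyadic
pay-down; (D-UNR) PRINT by ruling D74′), LEAD T13-42 price list; CENSUS-M1 `F0/P3c/LH4/LH4-p01/g6/CENSUS-M1-flicker-scalars.v1.md` bf2b9cff8e6aee20 row #7.  THIS FILE is
★ `UnitFundamentalLemmaInertSplitClauseOfValuesStubFrame` (F0P3a-p04 (g12)) BYTE-PARALLEL with the scalar binders `{e π π' x y} (h2e) (hx) (hy)` REPLACED by the trace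
scalars `{b π π' ε} (hb : b + σb = 1) (hε : σε·ε = −1)` and Flicker's four literals replaced by the TRACE literals `t₁^{(b)}(a,u,d)`, `t_π^{(b)}(a,u,d)`, `t_π^{(b)}(a,d,u)`,
`t_π^{(b)}(u,a,d)` (★ p851833 `exists_four_matched_trace_representatives`, design (D): integral conjugators `diag(π,1,1)`, `g₃`, `g₄`); the signs `κ = (+,+,−,−)` are ★ p851771
`finKappaAt_trace_representatives_eq` (F0P3a-p08 (g25)) with its Gram hypotheses `hG₃ hG₄` discharged by ★ `FlickerTraceFramePermutation`; HEAD 1 (★ p841086) and the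
exponent (★ A-p13) are 2-free and reused by name.  The four VALUES `X₁ … X₄` stay HYPOTHESES labelled by the trace literals (values-abstract: the count heads of the trace
engine plug at the consumer, never here).  HONEST READER LABEL: BANKED base layer; HC_CM is proved only modulo the 7 printed citations (2 remaining named inputs: hLiu418 =
stmt-HodgeConjecture-24832, h413 = stmt-HodgeConjecture-24833) until rung 0 closes; pays no organ, opens no road.

THE STATEMENT (**`finsum_finExplicitDelta_mul_classOrbitalIntegral_eq_of_split_of_traceValues`**, and the ED.-2 shape `…_traceValues'` carrying the level-preserving `ψ`): in the
frame of the line's `stub_splitGValueSum` (non-split unramified `w ∣ v` of good reduction for `H′`, `μ` unramified at `w`, `γ_H = (g, u)` with the split eigen-data: roots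
`α ≠ γ` of `χ_{g,w}` with `ord_w(α − u_w) = N₁`, `ord_w(γ − u_w) = N₂`), given the trace scalars `b, π, π′, ε ∈ E_v` and an eigenframe `g P₂ = P₂ diag(a, d)` over `E_v` with
norm-one `a ≠ d` off `u`, and FOUR VALUES `X₁ … X₄ ∈ ℂ` attached to the TRACE literals through ANY congruence `Tl` with `ᵗσ(Tl) Φ₃ Tl = H′_v`, one has
`∑ᶠ c, Δ‴_v(γ_H, out c) · Φ(c, f) = (−q_v)^{−(N₁+N₂)} · (X₁ + X₂ − X₃ − X₄)` for every test function `f` and orbital-measure family `mG`.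

## References
* [Flicker1998UnitaryFL] Y. Z. Flicker, *Elementary proof of the fundamental lemma for a unitary group*, Canad. J. Math. 50 (1998), Prop. 3 p. 78, §3 p. 80, §6 p. 95.
* [Rogawski1990] J. D. Rogawski, *Automorphic Representations of Unitary Groups in Three Variables* (1990), §4.3 (4.3.1)–(4.3.2) p. 43, §4.9 Prop. 4.9.1 (b) p. 55.
* [Jacobowitz1962] R. Jacobowitz, *Hermitian forms over local fields*, Amer. J. Math. 84 (1962), §7 Thm. 7.1 (the trace condition at an unramified dyadic place).
-/

set_option autoImplicit false

noncomputable section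

open NumberField IsDedekindDomain Matrix Polynomial
open scoped MatrixGroups

namespace Literature.NumberTheory.Rogawski1990

open Literature.NumberTheory.Automorphic Literature.NumberTheory.Automorphic.UnitaryGroup
open Literature.NumberTheory.GaloisRepresentations Literature.NumberTheory.NumberFields Literature.NumberTheory.QuadraticForms

section Adapter

variable (L : Type) [Field L] [NumberField L] [IsCMField L] {v : HeightOneSpectrum (𝓞 ↥(maximalRealSubfield L))} (H' : Matrix (Fin 3) (Fin 3) L)

set_option maxHeartbeats 400000 in
open scoped Classical in
/-- **(F12) HEAD 3 OVER THE TRACE FRAME — THE TYPE-(1) `G′`-SIDE SUM FROM THE FOUR VALUES, in the stub frame** (twin of ★ `…_of_split_of_values`, binders `hb hε` replace `h2e hx hy`).  See the module docstring: `Xᵢ` is the orbital integral of `f` on the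
class of ANY `t ∈ G′_v` whose image `Tl t Tl⁻¹` under a congruence `Tl` (`ᵗσ(Tl) Φ₃ Tl = H′_v`) is the `i`-th TRACE literal at `(b; a, u, d; π)` (★ p851833); then
`∑ᶠ c, Δ‴_v(γ_H, out c)·Φ(c, f) = (−q_v)^{−(N₁+N₂)}·(X₁ + X₂ − X₃ − X₄)`. [cite: Flicker1998UnitaryFL, Prop. 3 p. 78; §6 p. 95]
[cite: Rogawski1990, §4.3 (4.3.1)–(4.3.2) p. 43; §4.9 Prop. 4.9.1 (b) p. 55] [cite: Jacobowitz1962, §7 Thm. 7.1] -/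
theorem finsum_finExplicitDelta_mul_classOrbitalIntegral_eq_of_split_of_traceValues
    (hH' : (H'.map (IsCMField.complexConj L))ᵀ = H') (w : PlacesOver L v)
    (hw : IsCMField.complexConj L • w.1 = w.1) (hv : Algebra.IsUnramifiedIn (𝓞 L) v.asIdeal)
    (hH'w : IsUnit (placeForm H' w.1)) (hH'i : hH'w.unit ∈ glInt 3 (w.1.adicCompletion L))
    (μ : HeckeCharacter L) (hμ : μ.IsUnramifiedAt w.1)
    [∀ γ : ((cmDatum L 3 H').Local v), MeasurableSpace (((cmDatum L 3 H').Local v) ⧸ Subgroup.centralizer ({γ} : Set ((cmDatum L 3 H').Local v)))]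
    (hl : ∀ (v : HeightOneSpectrum (𝓞 ↥(maximalRealSubfield L)))
      (a : (cmDatum L 2 (Matrix.of fun i j : Fin 2 => if i.val + j.val + 1 = 2 then (1 : L) else 0)).Local v ×
      (cmDatum L 1 (Matrix.of fun i j : Fin 1 => if i.val + j.val + 1 = 1 then (1 : L) else 0)).Local v)
      (b : (cmDatum L 3 H').Local v)
      (x : (cmDatum L 2 (Matrix.of fun i j : Fin 2 => if i.val + j.val + 1 = 2 then (1 : L) else 0)).Local v ×
      (cmDatum L 1 (Matrix.of fun i j : Fin 1 => if i.val + j.val + 1 = 1 then (1 : L) else 0)).Local v),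
      finExplicitDelta L v H' (x * a * x⁻¹) μ b = finExplicitDelta L v H' a μ b)
    (hr : ∀ (v : HeightOneSpectrum (𝓞 ↥(maximalRealSubfield L)))
      (a : (cmDatum L 2 (Matrix.of fun i j : Fin 2 => if i.val + j.val + 1 = 2 then (1 : L) else 0)).Local v ×
      (cmDatum L 1 (Matrix.of fun i j : Fin 1 => if i.val + j.val + 1 = 1 then (1 : L) else 0)).Local v)
      (b y : (cmDatum L 3 H').Local v),
      finExplicitDelta L v H' a μ (y * b * y⁻¹) = finExplicitDelta L v H' a μ b)
    (hH'u : IsUnit H')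
    (hμω : ∀ x : ideleGroup ↥(maximalRealSubfield L), μ (AdeleRing.ideleBaseChange ↥(maximalRealSubfield L) L x) = quadraticHeckeCharCM L x)
    {γH : ((cmDatum L 2 (Matrix.of fun i j : Fin 2 => if i.val + j.val + 1 = 2 then (1 : L) else 0)).Local v ×
      (cmDatum L 1 (Matrix.of fun i j : Fin 1 => if i.val + j.val + 1 = 1 then (1 : L) else 0)).Local v)}
    -- the split eigen-data of `stub_splitExponents`
    (α γ : w.1.adicCompletion L) (N₁ N₂ : ℕ)
    (hα : ((((γH.1.val : GL (Fin 2) (LocalRing L v)) : Matrix (Fin 2) (Fin 2) (LocalRing L v)).charpoly).map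
        (Pi.evalRingHom (fun w' : PlacesOver L v => w'.1.adicCompletion L) w)).IsRoot α)
    (hγ : ((((γH.1.val : GL (Fin 2) (LocalRing L v)) : Matrix (Fin 2) (Fin 2) (LocalRing L v)).charpoly).map
        (Pi.evalRingHom (fun w' : PlacesOver L v => w'.1.adicCompletion L) w)).IsRoot γ)
    (hαγ : α ≠ γ)
    (hN₁ : Valued.v (α - finGammaTwo L v γH w) = WithZero.exp (-(N₁ : ℤ)))
    (hN₂ : Valued.v (γ - finGammaTwo L v γH w) = WithZero.exp (-(N₂ : ℤ)))
    -- the TRACE scalars (★ A-p12 `FlickerScalarsTraceCM`) and an eigenframe of `g` over `E_v` (★ (E1))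
    {b π π' ε a d : LocalRing L v} (hb : b + conjLocal L (IsCMField.complexConj L) v b = 1) (hσπ : conjLocal L (IsCMField.complexConj L) v π = π)
    (hππ : π * π' = 1) (hπN : ∀ z : LocalRing L v, conjLocal L (IsCMField.complexConj L) v z * z ≠ π)
    (hε : conjLocal L (IsCMField.complexConj L) v ε * ε = -1)
    (ha1 : conjLocal L (IsCMField.complexConj L) v a * a = 1) (hd1 : conjLocal L (IsCMField.complexConj L) v d * d = 1)
    {P₂ : GL (Fin 2) (LocalRing L v)} (hP₂ : (γH.1.val.val : Matrix (Fin 2) (Fin 2) (LocalRing L v)) * P₂.val = P₂.val * diagonal ![a, d])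
    (had : a ≠ d) (hab : a ≠ finGammaTwo L v γH) (hbd : finGammaTwo L v γH ≠ d)
    -- the test function, the family, and the four VALUES labelled by the TRACE literals (★ p851833)
    (mG : OrbitalMeasureFamily ((cmDatum L 3 H').Local v)) (f : (cmDatum L 3 H').Local v → ℂ) {X₁ X₂ X₃ X₄ : ℂ}
    (hΦ₁ : ∀ (Tl : GL (Fin 3) (LocalRing L v)) (t : (cmDatum L 3 H').Local v),
      formCongr (conjLocal L (IsCMField.complexConj L) v) Tl (Matrix.of fun i j : Fin 3 => if i.val + j.val + 1 = 3 then (1 : LocalRing L v) else 0) =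
          (adelicForm L 3 H').map (adeleToLocal L v) →
      (Tl * t.val * Tl⁻¹).val =
          !![a * conjLocal L (IsCMField.complexConj L) v b + d * b, 0, a - d; 0, finGammaTwo L v γH, 0;
                    b * conjLocal L (IsCMField.complexConj L) v b * (a - d), 0, a * b + d * conjLocal L (IsCMField.complexConj L) v b] →
      classOrbitalIntegral mG f (ConjClasses.mk t) = X₁)
    (hΦ₂ : ∀ (Tl : GL (Fin 3) (LocalRing L v)) (t : (cmDatum L 3 H').Local v),
      formCongr (conjLocal L (IsCMField.complexConj L) v) Tl (Matrix.of fun i j : Fin 3 => if i.val + j.val + 1 = 3 then (1 : LocalRing L v) else 0) =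
          (adelicForm L 3 H').map (adeleToLocal L v) →
      (Tl * t.val * Tl⁻¹).val =
          !![a * conjLocal L (IsCMField.complexConj L) v b + d * b, 0, π * (a - d); 0, finGammaTwo L v γH, 0;
                    π' * (b * conjLocal L (IsCMField.complexConj L) v b * (a - d)), 0, a * b + d * conjLocal L (IsCMField.complexConj L) v b] →
      classOrbitalIntegral mG f (ConjClasses.mk t) = X₂)
    (hΦ₃ : ∀ (Tl : GL (Fin 3) (LocalRing L v)) (t : (cmDatum L 3 H').Local v),
      formCongr (conjLocal L (IsCMField.complexConj L) v) Tl (Matrix.of fun i j : Fin 3 => if i.val + j.val + 1 = 3 then (1 : LocalRing L v) else 0) =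
          (adelicForm L 3 H').map (adeleToLocal L v) →
      (Tl * t.val * Tl⁻¹).val =
          !![a * conjLocal L (IsCMField.complexConj L) v b + finGammaTwo L v γH * b, 0, π * (a - finGammaTwo L v γH); 0, d, 0;
                    π' * (b * conjLocal L (IsCMField.complexConj L) v b * (a - finGammaTwo L v γH)), 0,
                    a * b + finGammaTwo L v γH * conjLocal L (IsCMField.complexConj L) v b] →
      classOrbitalIntegral mG f (ConjClasses.mk t) = X₃)
    (hΦ₄ : ∀ (Tl : GL (Fin 3) (LocalRing L v)) (t : (cmDatum L 3 H').Local v),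
      formCongr (conjLocal L (IsCMField.complexConj L) v) Tl (Matrix.of fun i j : Fin 3 => if i.val + j.val + 1 = 3 then (1 : LocalRing L v) else 0) =
          (adelicForm L 3 H').map (adeleToLocal L v) →
      (Tl * t.val * Tl⁻¹).val =
          !![finGammaTwo L v γH * conjLocal L (IsCMField.complexConj L) v b + d * b, 0, π * (finGammaTwo L v γH - d); 0, a, 0;
                    π' * (b * conjLocal L (IsCMField.complexConj L) v b * (finGammaTwo L v γH - d)), 0,
                    finGammaTwo L v γH * b + d * conjLocal L (IsCMField.complexConj L) v b] →
      classOrbitalIntegral mG f (ConjClasses.mk t) = X₄) :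
    ∑ᶠ c : ConjClasses ((cmDatum L 3 H').Local v),
        (finExplicitCollection L H' μ hl hr v).Δ γH (Quotient.out c) * classOrbitalIntegral mG f c =
      (-(Ideal.absNorm v.asIdeal : ℂ)) ^ (-((N₁ : ℤ) + N₂)) * (X₁ + X₂ - X₃ - X₄) := by
  have hvs : Subsingleton (PlacesOver L v) :=
    PlacesOver.subsingleton_of_smul_eq (IsCMField.complexConj L) (IsCMField.complexConj_ne_one L) w hw
  -- (1) `χ_g(u)` is a unit and the exponent is `−(N₁+N₂)` (★ A-p13)
  have hα' : ((finCharpolyTwo L v γH).map (Pi.evalRingHom (fun w' : PlacesOver L v => w'.1.adicCompletion L) w)).IsRoot α := hα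
  have hγ' : ((finCharpolyTwo L v γH).map (Pi.evalRingHom (fun w' : PlacesOver L v => w'.1.adicCompletion L) w)).IsRoot γ := hγ
  have hαb : α ≠ finGammaTwo L v γH w := fun h0 => by
    rw [h0, sub_self, map_zero] at hN₁; exact WithZero.zero_ne_coe hN₁
  have hγb : γ ≠ finGammaTwo L v γH w := fun h0 => by
    rw [h0, sub_self, map_zero] at hN₂; exact WithZero.zero_ne_coe hN₂
  have hu : IsUnit ((finCharpolyTwo L v γH).eval (finGammaTwo L v γH)) := isUnit_eval_finCharpolyTwo_of_isRoot L v w γH hvs hα' hγ' hαγ hαb hγb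
  have hlog := log_valued_eval_finCharpolyTwo_apply_eq_neg_add L v w γH hα' hγ' hαγ hN₁ hN₂
  -- (2) the local hermitian data of `H′`
  have hH'c : (H'.map (cmConjRingHom L))ᵀ = H' := by
    have e1 : H'.map (cmConjRingHom L) = H'.map (IsCMField.complexConj L) := by
      ext i j; simp [Matrix.map_apply, cmConjRingHom_apply]
    rw [e1]; exact hH'
  have hH := map_conjLocal_transpose_localForm L 3 H' v hH'c
  have hHd := isUnit_det_localForm L 3 H' v (Matrix.isUnit_iff_isUnit_det _ |>.1 hH'u).ne_zero
  -- (3) the four matched TRACE representatives (★ p851833)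
  obtain ⟨Tl, ψ, t₁, t₂, t₃, t₄, τ₁, τ₂, τ₃, τ₄, P, Q, dπ, g₃, g₄, hform, hψ, -, -, h₁, h₂, h₃, h₄, hP, hu', hu'1, hPQ, hQ,
    hψ₁, hψ₂, hψ₃, hψ₄, hτ₁, hτ₂c, hτ₃c, hτ₄c, hdπ, hg₃, hg₄, hτ₂, hτ₃, hτ₄, n12, n34⟩ :=
    exists_four_matched_trace_representatives L H' hH' w hw hv hH'w hH'i (γH := γH) hb hσπ hππ hπN hε ha1 hd1 hP₂ had hab hbd
  -- images: `Tl tᵢ Tl⁻¹ = (ψ tᵢ) = τᵢ`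
  have himg : ∀ {t : (cmDatum L 3 H').Local v} {τ : ↥(UnitaryGroup.«local» L (IsCMField.complexConj L) 3
      (Matrix.of fun i j : Fin 3 => if i.val + j.val + 1 = 3 then (1 : L) else 0) v)}, ψ t = τ → Tl * t.val * Tl⁻¹ = τ.val := by
    intro t τ h
    rw [← hψ t, h]
  -- (4) the signs (★ p851771 in the trace frame; Grams of `g₃·Q_b`, `g₄·Q_b` by ★ `FlickerTraceFramePermutation`)
  obtain ⟨αg, hα0, hcα, -⟩ := cmQuadraticGenerator_spec L
  have hσσ : ∀ x, conjLocal L (IsCMField.complexConj L) v (conjLocal L (IsCMField.complexConj L) v x) = x :=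
    fun x => Liu2021.LemD1OfPlace.conjLocal_conjLocal_apply L v (IsCMField.complexConj L) hcα hα0 x
  have hG₃ : twistGram (conjLocal L (IsCMField.complexConj L) v) (Matrix.of fun i j : Fin 3 => if i.val + j.val + 1 = 3 then (1 : LocalRing L v) else 0)
      (g₃.val * Q.val) = !![π, 0, 0; 0, -π, 0; 0, 0, -1] := by
    rw [hg₃, hQ, gThreeTrace_mul_traceFrame _ hb, twistGram_traceFrameThree _ hσσ hb hσπ hε]
  have hG₄ : twistGram (conjLocal L (IsCMField.complexConj L) v) (Matrix.of fun i j : Fin 3 => if i.val + j.val + 1 = 3 then (1 : LocalRing L v) else 0)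
      (g₄.val * Q.val) = !![1, 0, 0; 0, π, 0; 0, 0, -π] := by
    rw [hg₄, hQ, gFourTrace_mul_traceFrame _ hb, twistGram_traceFrameFour _ hσσ hb hσπ]
  obtain ⟨hκ₁, hκ₂, hκ₃, hκ₄⟩ := finKappaAt_trace_representatives_eq L v H' γH w hw hu hH hHd hb hε hσπ hπN hform h₁ h₃ h₄ hP hu' hu'1 hPQ hQ
    hdπ hG₃ hG₄ (by rw [himg hψ₂, himg hψ₁, hτ₂c]) (by rw [himg hψ₃, himg hψ₁, hτ₃c]) (by rw [himg hψ₄, himg hψ₁, hτ₄c])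
  -- (5) the values at the four classes
  have hX₁ : classOrbitalIntegral mG f (ConjClasses.mk t₁) = X₁ := hΦ₁ Tl t₁ hform (by rw [himg hψ₁, hτ₁])
  have hX₂ : classOrbitalIntegral mG f (ConjClasses.mk t₂) = X₂ := hΦ₂ Tl t₂ hform (by rw [himg hψ₂, hτ₂])
  have hX₃ : classOrbitalIntegral mG f (ConjClasses.mk t₃) = X₃ := hΦ₃ Tl t₃ hform (by rw [himg hψ₃, hτ₃])
  have hX₄ : classOrbitalIntegral mG f (ConjClasses.mk t₄) = X₄ := hΦ₄ Tl t₄ hform (by rw [himg hψ₄, hτ₄])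
  -- (6) HEAD 1 and the exponent
  rw [finsum_delta_mul_classOrbitalIntegral_eq_of_four_classes_of_values L v H' γH w hw μ hμω hv hμ hl hr h₁ h₂ h₃ h₄ hu hH hHd hP hu' hu'1 n12 n34
    hκ₁ hκ₂ hκ₃ hκ₄ mG f hX₁ hX₂ hX₃ hX₄, hlog]

open scoped Classical in
/-- **(F12) HEAD 3 OVER THE TRACE FRAME, ED.-2 SHAPE — the value labels carry the LEVEL-PRESERVING CONGRUENCE `ψ`** (twin of ★ `…_of_split_of_values'`) (weaker hypotheses on the four values, so the value theorems plug ★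
F0P3-p02's `natCard_fixedBy_cmLocalIntegralLevel_eq_of_congr (ψ) (hlev)` directly): `Xᵢ` is the orbital integral of `f` on the class of ANY `t ∈ G′_v` for which SOME
congruence `Tl` (`ᵗσ(Tl) Φ₃ Tl = H′_v`) with a topological-group isomorphism `ψ : G′_v ≃ U(Φ₃)(L⁺_v)`, `ψ g = Tl g Tl⁻¹`, PRESERVING THE LEVELS (`g ∈ K′ ↔ ψ g ∈ K_Φ`),
maps `t` to the `i`-th TRACE literal; then `∑ᶠ c, Δ‴_v(γ_H, out c)·Φ(c, f) = (−q_v)^{−(N₁+N₂)}·(X₁ + X₂ − X₃ − X₄)`. (All of `Tl, ψ, hform, hψ, hlev` are conjuncts of ★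
`exists_four_matched_trace_representatives`.) [cite: Flicker1998UnitaryFL, Prop. 3 p. 78; §6 p. 95] [cite: Rogawski1990, §4.3 (4.3.1)–(4.3.2) p. 43; §4.9 Prop. 4.9.1 (b) p. 55] -/
theorem finsum_finExplicitDelta_mul_classOrbitalIntegral_eq_of_split_of_traceValues'
    (hH' : (H'.map (IsCMField.complexConj L))ᵀ = H') (w : PlacesOver L v)
    (hw : IsCMField.complexConj L • w.1 = w.1) (hv : Algebra.IsUnramifiedIn (𝓞 L) v.asIdeal)
    (hH'w : IsUnit (placeForm H' w.1)) (hH'i : hH'w.unit ∈ glInt 3 (w.1.adicCompletion L))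
    (μ : HeckeCharacter L) (hμ : μ.IsUnramifiedAt w.1)
    [∀ γ : ((cmDatum L 3 H').Local v), MeasurableSpace (((cmDatum L 3 H').Local v) ⧸ Subgroup.centralizer ({γ} : Set ((cmDatum L 3 H').Local v)))]
    (hl : ∀ (v : HeightOneSpectrum (𝓞 ↥(maximalRealSubfield L)))
      (a : (cmDatum L 2 (Matrix.of fun i j : Fin 2 => if i.val + j.val + 1 = 2 then (1 : L) else 0)).Local v ×
      (cmDatum L 1 (Matrix.of fun i j : Fin 1 => if i.val + j.val + 1 = 1 then (1 : L) else 0)).Local v)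
      (b : (cmDatum L 3 H').Local v)
      (x : (cmDatum L 2 (Matrix.of fun i j : Fin 2 => if i.val + j.val + 1 = 2 then (1 : L) else 0)).Local v ×
      (cmDatum L 1 (Matrix.of fun i j : Fin 1 => if i.val + j.val + 1 = 1 then (1 : L) else 0)).Local v),
      finExplicitDelta L v H' (x * a * x⁻¹) μ b = finExplicitDelta L v H' a μ b)
    (hr : ∀ (v : HeightOneSpectrum (𝓞 ↥(maximalRealSubfield L)))
      (a : (cmDatum L 2 (Matrix.of fun i j : Fin 2 => if i.val + j.val + 1 = 2 then (1 : L) else 0)).Local v ×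
      (cmDatum L 1 (Matrix.of fun i j : Fin 1 => if i.val + j.val + 1 = 1 then (1 : L) else 0)).Local v)
      (b y : (cmDatum L 3 H').Local v),
      finExplicitDelta L v H' a μ (y * b * y⁻¹) = finExplicitDelta L v H' a μ b)
    (hH'u : IsUnit H')
    (hμω : ∀ x : ideleGroup ↥(maximalRealSubfield L), μ (AdeleRing.ideleBaseChange ↥(maximalRealSubfield L) L x) = quadraticHeckeCharCM L x)
    {γH : ((cmDatum L 2 (Matrix.of fun i j : Fin 2 => if i.val + j.val + 1 = 2 then (1 : L) else 0)).Local v ×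
      (cmDatum L 1 (Matrix.of fun i j : Fin 1 => if i.val + j.val + 1 = 1 then (1 : L) else 0)).Local v)}
    -- the split eigen-data of `stub_splitExponents`
    (α γ : w.1.adicCompletion L) (N₁ N₂ : ℕ)
    (hα : ((((γH.1.val : GL (Fin 2) (LocalRing L v)) : Matrix (Fin 2) (Fin 2) (LocalRing L v)).charpoly).map
        (Pi.evalRingHom (fun w' : PlacesOver L v => w'.1.adicCompletion L) w)).IsRoot α)
    (hγ : ((((γH.1.val : GL (Fin 2) (LocalRing L v)) : Matrix (Fin 2) (Fin 2) (LocalRing L v)).charpoly).map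
        (Pi.evalRingHom (fun w' : PlacesOver L v => w'.1.adicCompletion L) w)).IsRoot γ)
    (hαγ : α ≠ γ)
    (hN₁ : Valued.v (α - finGammaTwo L v γH w) = WithZero.exp (-(N₁ : ℤ)))
    (hN₂ : Valued.v (γ - finGammaTwo L v γH w) = WithZero.exp (-(N₂ : ℤ)))
    -- the TRACE scalars (★ A-p12 `FlickerScalarsTraceCM`) and an eigenframe of `g` over `E_v` (★ (E1))
    {b π π' ε a d : LocalRing L v} (hb : b + conjLocal L (IsCMField.complexConj L) v b = 1) (hσπ : conjLocal L (IsCMField.complexConj L) v π = π)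
    (hππ : π * π' = 1) (hπN : ∀ z : LocalRing L v, conjLocal L (IsCMField.complexConj L) v z * z ≠ π)
    (hε : conjLocal L (IsCMField.complexConj L) v ε * ε = -1)
    (ha1 : conjLocal L (IsCMField.complexConj L) v a * a = 1) (hd1 : conjLocal L (IsCMField.complexConj L) v d * d = 1)
    {P₂ : GL (Fin 2) (LocalRing L v)} (hP₂ : (γH.1.val.val : Matrix (Fin 2) (Fin 2) (LocalRing L v)) * P₂.val = P₂.val * diagonal ![a, d])
    (had : a ≠ d) (hab : a ≠ finGammaTwo L v γH) (hbd : finGammaTwo L v γH ≠ d)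
    -- the test function, the family, and the four VALUES labelled by the TRACE literals (★ p851833)
    (mG : OrbitalMeasureFamily ((cmDatum L 3 H').Local v)) (f : (cmDatum L 3 H').Local v → ℂ) {X₁ X₂ X₃ X₄ : ℂ}
    (hΦ₁ : ∀ (Tl : GL (Fin 3) (LocalRing L v)) (ψ : ↥(UnitaryGroup.«local» L (IsCMField.complexConj L) 3 H' v) ≃ₜ*
        ↥(UnitaryGroup.«local» L (IsCMField.complexConj L) 3 (Matrix.of fun i j : Fin 3 => if i.val + j.val + 1 = 3 then (1 : L) else 0) v))
      (t : (cmDatum L 3 H').Local v),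
      formCongr (conjLocal L (IsCMField.complexConj L) v) Tl (Matrix.of fun i j : Fin 3 => if i.val + j.val + 1 = 3 then (1 : LocalRing L v) else 0) =
          (adelicForm L 3 H').map (adeleToLocal L v) →
      (∀ g, (ψ g).val = Tl * g.val * Tl⁻¹) →
      (∀ g, g ∈ cmLocalIntegralLevel L 3 H' v ↔
        ψ g ∈ cmLocalIntegralLevel L 3 (Matrix.of fun i j : Fin 3 => if i.val + j.val + 1 = 3 then (1 : L) else 0) v) →
      (ψ t).val.val =
          !![a * conjLocal L (IsCMField.complexConj L) v b + d * b, 0, a - d; 0, finGammaTwo L v γH, 0;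
                    b * conjLocal L (IsCMField.complexConj L) v b * (a - d), 0, a * b + d * conjLocal L (IsCMField.complexConj L) v b] →
      classOrbitalIntegral mG f (ConjClasses.mk t) = X₁)
    (hΦ₂ : ∀ (Tl : GL (Fin 3) (LocalRing L v)) (ψ : ↥(UnitaryGroup.«local» L (IsCMField.complexConj L) 3 H' v) ≃ₜ*
        ↥(UnitaryGroup.«local» L (IsCMField.complexConj L) 3 (Matrix.of fun i j : Fin 3 => if i.val + j.val + 1 = 3 then (1 : L) else 0) v))
      (t : (cmDatum L 3 H').Local v),
      formCongr (conjLocal L (IsCMField.complexConj L) v) Tl (Matrix.of fun i j : Fin 3 => if i.val + j.val + 1 = 3 then (1 : LocalRing L v) else 0) =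
          (adelicForm L 3 H').map (adeleToLocal L v) →
      (∀ g, (ψ g).val = Tl * g.val * Tl⁻¹) →
      (∀ g, g ∈ cmLocalIntegralLevel L 3 H' v ↔
        ψ g ∈ cmLocalIntegralLevel L 3 (Matrix.of fun i j : Fin 3 => if i.val + j.val + 1 = 3 then (1 : L) else 0) v) →
      (ψ t).val.val =
          !![a * conjLocal L (IsCMField.complexConj L) v b + d * b, 0, π * (a - d); 0, finGammaTwo L v γH, 0;
                    π' * (b * conjLocal L (IsCMField.complexConj L) v b * (a - d)), 0, a * b + d * conjLocal L (IsCMField.complexConj L) v b] →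
      classOrbitalIntegral mG f (ConjClasses.mk t) = X₂)
    (hΦ₃ : ∀ (Tl : GL (Fin 3) (LocalRing L v)) (ψ : ↥(UnitaryGroup.«local» L (IsCMField.complexConj L) 3 H' v) ≃ₜ*
        ↥(UnitaryGroup.«local» L (IsCMField.complexConj L) 3 (Matrix.of fun i j : Fin 3 => if i.val + j.val + 1 = 3 then (1 : L) else 0) v))
      (t : (cmDatum L 3 H').Local v),
      formCongr (conjLocal L (IsCMField.complexConj L) v) Tl (Matrix.of fun i j : Fin 3 => if i.val + j.val + 1 = 3 then (1 : LocalRing L v) else 0) =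
          (adelicForm L 3 H').map (adeleToLocal L v) →
      (∀ g, (ψ g).val = Tl * g.val * Tl⁻¹) →
      (∀ g, g ∈ cmLocalIntegralLevel L 3 H' v ↔
        ψ g ∈ cmLocalIntegralLevel L 3 (Matrix.of fun i j : Fin 3 => if i.val + j.val + 1 = 3 then (1 : L) else 0) v) →
      (ψ t).val.val =
          !![a * conjLocal L (IsCMField.complexConj L) v b + finGammaTwo L v γH * b, 0, π * (a - finGammaTwo L v γH); 0, d, 0;
                    π' * (b * conjLocal L (IsCMField.complexConj L) v b * (a - finGammaTwo L v γH)), 0,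
                    a * b + finGammaTwo L v γH * conjLocal L (IsCMField.complexConj L) v b] →
      classOrbitalIntegral mG f (ConjClasses.mk t) = X₃)
    (hΦ₄ : ∀ (Tl : GL (Fin 3) (LocalRing L v)) (ψ : ↥(UnitaryGroup.«local» L (IsCMField.complexConj L) 3 H' v) ≃ₜ*
        ↥(UnitaryGroup.«local» L (IsCMField.complexConj L) 3 (Matrix.of fun i j : Fin 3 => if i.val + j.val + 1 = 3 then (1 : L) else 0) v))
      (t : (cmDatum L 3 H').Local v),
      formCongr (conjLocal L (IsCMField.complexConj L) v) Tl (Matrix.of fun i j : Fin 3 => if i.val + j.val + 1 = 3 then (1 : LocalRing L v) else 0) =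
          (adelicForm L 3 H').map (adeleToLocal L v) →
      (∀ g, (ψ g).val = Tl * g.val * Tl⁻¹) →
      (∀ g, g ∈ cmLocalIntegralLevel L 3 H' v ↔
        ψ g ∈ cmLocalIntegralLevel L 3 (Matrix.of fun i j : Fin 3 => if i.val + j.val + 1 = 3 then (1 : L) else 0) v) →
      (ψ t).val.val =
          !![finGammaTwo L v γH * conjLocal L (IsCMField.complexConj L) v b + d * b, 0, π * (finGammaTwo L v γH - d); 0, a, 0;
                    π' * (b * conjLocal L (IsCMField.complexConj L) v b * (finGammaTwo L v γH - d)), 0,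
                    finGammaTwo L v γH * b + d * conjLocal L (IsCMField.complexConj L) v b] →
      classOrbitalIntegral mG f (ConjClasses.mk t) = X₄) :
    ∑ᶠ c : ConjClasses ((cmDatum L 3 H').Local v),
        (finExplicitCollection L H' μ hl hr v).Δ γH (Quotient.out c) * classOrbitalIntegral mG f c =
      (-(Ideal.absNorm v.asIdeal : ℂ)) ^ (-((N₁ : ℤ) + N₂)) * (X₁ + X₂ - X₃ - X₄) := by
  have hvs : Subsingleton (PlacesOver L v) :=
    PlacesOver.subsingleton_of_smul_eq (IsCMField.complexConj L) (IsCMField.complexConj_ne_one L) w hw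
  -- (1) `χ_g(u)` is a unit and the exponent is `−(N₁+N₂)` (★ A-p13)
  have hα' : ((finCharpolyTwo L v γH).map (Pi.evalRingHom (fun w' : PlacesOver L v => w'.1.adicCompletion L) w)).IsRoot α := hα
  have hγ' : ((finCharpolyTwo L v γH).map (Pi.evalRingHom (fun w' : PlacesOver L v => w'.1.adicCompletion L) w)).IsRoot γ := hγ
  have hαb : α ≠ finGammaTwo L v γH w := fun h0 => by
    rw [h0, sub_self, map_zero] at hN₁; exact WithZero.zero_ne_coe hN₁
  have hγb : γ ≠ finGammaTwo L v γH w := fun h0 => by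
    rw [h0, sub_self, map_zero] at hN₂; exact WithZero.zero_ne_coe hN₂
  have hu : IsUnit ((finCharpolyTwo L v γH).eval (finGammaTwo L v γH)) := isUnit_eval_finCharpolyTwo_of_isRoot L v w γH hvs hα' hγ' hαγ hαb hγb
  have hlog := log_valued_eval_finCharpolyTwo_apply_eq_neg_add L v w γH hα' hγ' hαγ hN₁ hN₂
  -- (2) the local hermitian data of `H′`
  have hH'c : (H'.map (cmConjRingHom L))ᵀ = H' := by
    have e1 : H'.map (cmConjRingHom L) = H'.map (IsCMField.complexConj L) := by
      ext i j; simp [Matrix.map_apply, cmConjRingHom_apply]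
    rw [e1]; exact hH'
  have hH := map_conjLocal_transpose_localForm L 3 H' v hH'c
  have hHd := isUnit_det_localForm L 3 H' v (Matrix.isUnit_iff_isUnit_det _ |>.1 hH'u).ne_zero
  -- (3) the four matched TRACE representatives (★ p851833)
  obtain ⟨Tl, ψ, t₁, t₂, t₃, t₄, τ₁, τ₂, τ₃, τ₄, P, Q, dπ, g₃, g₄, hform, hψ, -, hlev, h₁, h₂, h₃, h₄, hP, hu', hu'1, hPQ, hQ,
    hψ₁, hψ₂, hψ₃, hψ₄, hτ₁, hτ₂c, hτ₃c, hτ₄c, hdπ, hg₃, hg₄, hτ₂, hτ₃, hτ₄, n12, n34⟩ :=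
    exists_four_matched_trace_representatives L H' hH' w hw hv hH'w hH'i (γH := γH) hb hσπ hππ hπN hε ha1 hd1 hP₂ had hab hbd
  -- images: `Tl tᵢ Tl⁻¹ = (ψ tᵢ) = τᵢ`
  have himg : ∀ {t : (cmDatum L 3 H').Local v} {τ : ↥(UnitaryGroup.«local» L (IsCMField.complexConj L) 3
      (Matrix.of fun i j : Fin 3 => if i.val + j.val + 1 = 3 then (1 : L) else 0) v)}, ψ t = τ → Tl * t.val * Tl⁻¹ = τ.val := by
    intro t τ h
    rw [← hψ t, h]
  -- (4) the signs (★ p851771 in the trace frame; Grams of `g₃·Q_b`, `g₄·Q_b` by ★ `FlickerTraceFramePermutation`)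
  obtain ⟨αg, hα0, hcα, -⟩ := cmQuadraticGenerator_spec L
  have hσσ : ∀ x, conjLocal L (IsCMField.complexConj L) v (conjLocal L (IsCMField.complexConj L) v x) = x :=
    fun x => Liu2021.LemD1OfPlace.conjLocal_conjLocal_apply L v (IsCMField.complexConj L) hcα hα0 x
  have hG₃ : twistGram (conjLocal L (IsCMField.complexConj L) v) (Matrix.of fun i j : Fin 3 => if i.val + j.val + 1 = 3 then (1 : LocalRing L v) else 0)
      (g₃.val * Q.val) = !![π, 0, 0; 0, -π, 0; 0, 0, -1] := by
    rw [hg₃, hQ, gThreeTrace_mul_traceFrame _ hb, twistGram_traceFrameThree _ hσσ hb hσπ hε]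
  have hG₄ : twistGram (conjLocal L (IsCMField.complexConj L) v) (Matrix.of fun i j : Fin 3 => if i.val + j.val + 1 = 3 then (1 : LocalRing L v) else 0)
      (g₄.val * Q.val) = !![1, 0, 0; 0, π, 0; 0, 0, -π] := by
    rw [hg₄, hQ, gFourTrace_mul_traceFrame _ hb, twistGram_traceFrameFour _ hσσ hb hσπ]
  obtain ⟨hκ₁, hκ₂, hκ₃, hκ₄⟩ := finKappaAt_trace_representatives_eq L v H' γH w hw hu hH hHd hb hε hσπ hπN hform h₁ h₃ h₄ hP hu' hu'1 hPQ hQ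
    hdπ hG₃ hG₄ (by rw [himg hψ₂, himg hψ₁, hτ₂c]) (by rw [himg hψ₃, himg hψ₁, hτ₃c]) (by rw [himg hψ₄, himg hψ₁, hτ₄c])
  -- (5) the values at the four classes
  have hX₁ : classOrbitalIntegral mG f (ConjClasses.mk t₁) = X₁ := hΦ₁ Tl ψ t₁ hform hψ hlev (by rw [hψ₁, hτ₁])
  have hX₂ : classOrbitalIntegral mG f (ConjClasses.mk t₂) = X₂ := hΦ₂ Tl ψ t₂ hform hψ hlev (by rw [hψ₂, hτ₂])
  have hX₃ : classOrbitalIntegral mG f (ConjClasses.mk t₃) = X₃ := hΦ₃ Tl ψ t₃ hform hψ hlev (by rw [hψ₃, hτ₃])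
  have hX₄ : classOrbitalIntegral mG f (ConjClasses.mk t₄) = X₄ := hΦ₄ Tl ψ t₄ hform hψ hlev (by rw [hψ₄, hτ₄])
  -- (6) HEAD 1 and the exponent
  rw [finsum_delta_mul_classOrbitalIntegral_eq_of_four_classes_of_values L v H' γH w hw μ hμω hv hμ hl hr h₁ h₂ h₃ h₄ hu hH hHd hP hu' hu'1 n12 n34
    hκ₁ hκ₂ hκ₃ hκ₄ mG f hX₁ hX₂ hX₃ hX₄, hlog]

end Adapter

end Literature.NumberTheory.Rogawski1990

end
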